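import Summits.CriticalPhenomena.CardyFormulaZ2.Theses.CardyRotToConf
import Literature.Probability.RandomPlanarGeometry.SLEUniquenessInLaw

/-!
# Crux-triage certificate (triager r1-1) for stmt-CriticalPhenomena-0698 — card `crossing-data-scalarise`

F2: the antecedent of the card's determination statement `DeterminedByCrossings`
(Sketch-ideator3.lean, copied verbatim below) is VACUOUS: in a 3-marked domain the closed arc
`arc 2 = [pt 2, pt 0]` contains the source `pt 0` of the curve of `P (D.chord 0 1)`, while
`hitsBefore A B` forbids `γ s ∈ B` already at `s = 0`; hence the event is null for every chordal
family, the antecedent holds for ANY two chordal families, and `DeterminedByCrossings` as typed is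
literally "any two admissible non-tracing families are equal" — which the crux itself implies
(`IsSLELaw.unique'`) and which, given one admissible SLE₆ family, implies the crux. So the card's
transfer `C⁺ := CardyForAdmissibleFamilies ∧ DeterminedByCrossings` is, as typed, the crux in a
costume (its first conjunct is not even used).
-/

noncomputable section

namespace Summit.CriticalPhenomena.CardyFormulaZ2.Cruxes.CardyRotToConf_r2_symmetryUpgrade.Triage

open MeasureTheory Set
open scoped ENNReal
open Literature.Probability.RandomPlanarGeometry
open Summit.CriticalPhenomena.CardyFormulaZ2.Theses.CardyRotToConf (CardyRotToConfR2SymmetryUpgrade)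

/-- No class whose source lies in `B` belongs to `hitsBefore A B` (the clause `∀ s ≤ t, γ s ∉ B`
at `s = 0`). -/
theorem not_mem_hitsBefore_of_source_mem {A B : Set ℂ} {c : CurveClass ℂ} (hc : c.source ∈ B) :
    c ∉ CurveClass.hitsBefore A B := by
  rintro ⟨γ, ⟨t, -, ht⟩, rfl⟩
  exact ht 0 bot_le (by simpa [Curve.source_def] using hc)

/-- For a chordal family, "the curve from `pt 0` to `pt 1` hits `arc 1` before `arc 2`" is a null
event in every 3-marked domain, because `pt 0 ∈ arc 2`. -/
theorem chordal_hitsBefore_arc_one_arc_two_eq_zero (P : ChordalFamily) (hP : P.IsChordal)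
    (D : MarkedDomain 3) :
    P (D.chord 0 1 (by decide)) (CurveClass.hitsBefore (D.arc 1) (D.arc 2)) = 0 := by
  have h0 : (D.chord 0 1 (by decide)).pt 0 ∈ D.arc 2 := by
    rw [MarkedDomain.pt_chord_zero]
    simpa using D.pt_succ_mem_arc 2
  obtain ⟨-, hae⟩ := hP (D.chord 0 1 (by decide))
  have hnull : P (D.chord 0 1 (by decide))
      {c | ¬ c.source = (D.chord 0 1 (by decide)).pt 0} = 0 :=
    ae_iff.1 (hae.mono fun γ h => h.1)
  refine measure_mono_null (fun c hc => ?_) hnull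
  intro hcs
  exact not_mem_hitsBefore_of_source_mem (A := D.arc 1) (B := D.arc 2) (hcs ▸ h0) hc

/-- Verbatim copy of the card's `NonTracing` (Sketch-ideator3.lean) = the crux's clause. -/
def NonTracing (P : ChordalFamily) : Prop :=
  ∀ D : DobrushinDomain, ∀ᵐ γ ∂(P D), ∀ c : Curve ℂ, CurveClass.mk c = γ →
    ∀ s t : unitInterval, s < t → c '' Set.Icc s t ⊆ frontier D.carrier →
      (c '' Set.Icc s t).Subsingleton

/-- Verbatim copy of the card's `DeterminedByCrossings` (Sketch-ideator3.lean). -/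
def DeterminedByCrossings : Prop :=
  ∀ P P' : ChordalFamily, IsLocalMarkovChordalFamily P → NonTracing P →
    IsLocalMarkovChordalFamily P' → NonTracing P' →
    (∀ (D : MarkedDomain 3),
        P (D.chord 0 1 (by decide)) (CurveClass.hitsBefore (D.arc 1) (D.arc 2)) =
          P' (D.chord 0 1 (by decide)) (CurveClass.hitsBefore (D.arc 1) (D.arc 2))) →
      P = P'

/-- "At most one admissible non-tracing family." -/
def AllAdmissibleEqual : Prop :=
  ∀ P P' : ChordalFamily, IsLocalMarkovChordalFamily P → NonTracing P →
    IsLocalMarkovChordalFamily P' → NonTracing P' → P = P'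

/-- F2, certified: the card's determination statement IS "at most one admissible family" — its
crossing-data antecedent is automatically true. -/
theorem determinedByCrossings_iff : DeterminedByCrossings ↔ AllAdmissibleEqual := by
  constructor
  · intro h P P' hP hnt hP' hnt'
    refine h P P' hP hnt hP' hnt' fun D => ?_
    rw [chordal_hitsBefore_arc_one_arc_two_eq_zero P hP.isChordal,
      chordal_hitsBefore_arc_one_arc_two_eq_zero P' hP'.isChordal]
  · intro h P P' hP hnt hP' hnt' _
    exact h P P' hP hnt hP' hnt'

/-- The crux implies the card's statement outright (two admissible families have SLE₆ laws in every
domain, and SLE₆ laws are unique: `IsSLELaw.unique'`, unconditional in the tree). -/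
theorem determinedByCrossings_of_crux (h : CardyRotToConfR2SymmetryUpgrade) :
    DeterminedByCrossings := by
  rw [determinedByCrossings_iff]
  intro P P' hP hnt hP' hnt'
  funext D
  exact (h P hP hnt D).unique' (h P' hP' hnt' D)

/-- Conversely, given ONE admissible non-tracing family of SLE₆ laws (the non-vacuity everybody
assumes), the card's statement alone gives the crux — `CardyForAdmissibleFamilies` is not needed. -/
theorem crux_of_determinedByCrossings (h : DeterminedByCrossings)
    (P₆ : ChordalFamily) (h₆ : IsLocalMarkovChordalFamily P₆) (hnt₆ : NonTracing P₆)
    (hsle : ∀ D : DobrushinDomain, IsSLELaw 6 D (P₆ D)) :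
    CardyRotToConfR2SymmetryUpgrade := by
  intro P hP hnt D
  have : P = P₆ := (determinedByCrossings_iff.1 h) P P₆ hP hnt h₆ hnt₆
  rw [this]
  exact hsle D

end Summit.CriticalPhenomena.CardyFormulaZ2.Cruxes.CardyRotToConf_r2_symmetryUpgrade.Triage
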